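import Literature.NumberTheory.EllipticCurves.Rank1Residual.CyclotomicWindingSpan
import Literature.NumberTheory.Automorphic.CongruenceSubgroupPropertySL2Proofs
import Literature.NumberTheory.Automorphic.SL2AwayRelativeElementary
import Mathlib.RingTheory.Localization.Away.Basic
import Mathlib.Tactic.Group
import HarnessLib

/-!
# THEOREM B: the cyclotomic winding classes span `pr Γ_H(N)` for EVERY level — `ConjSpanGen N p` for all
# `N ≥ 1` and all primes `p ∤ N`, from the two printed inputs (L) Morris 2007 Thm. 6.1 (2) and (C) Serre 1970
# §2.6 Cor. 3 (cite-only Literature facts), everything else PROVED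

SPLIT NOTE (cell bsd-print-x8, seat p4 g2, landing the cell typer ty2 g6's farm-clean file
`HOME/ty2/ConjSpanGenAllLevels.lean.txt` sha16 323d4d2dc7a5d402 for a PROVER seat, gate rule D-0016): the
gate's lint «Theorems files with proofs are ≤ 400 lines» forces a split into THREE files by topic, all in the
SAME namespace `Summit.BirchSwinnertonDyer.BirchSwinnertonDyer.Theorems.ConjSpanGenAllLevels` (so every FQN,
e.g. `…ConjSpanGenAllLevels.conjSpanGenAll_of_vaserstein_away`, is the author's): (1/3)
`ConjSpanGenAllLevelsDefs.lean` — `OrbitTrick` + the `SL₂(ℤ[1/p])` objects and `Prop`s (incl. `RelGLeRelE`,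
`diagUnit`) + arithmetic of `ℤ[1/p]`; (2/3) `ConjSpanGenAllLevelsDecomposition.lean` — hypotheses (h1), (h2),
(V) ⟹ (E′), (h3), (h3′); (3/3) `ConjSpanGenAllLevels.lean` — THEOREM B kernel part, transpose bridge,
Vaserstein / Morris–Serre entries. THIS IS PART 1. Bodies VERBATIM; only docstrings were added to 21
helper lemmas (lint.docstring). Credit and audit trail unchanged (below).

Summit `BirchSwinnertonDyer`, sub-problem `BirchSwinnertonDyer`, `Theorems/` (flat, prover files); namespace
`Summit.BirchSwinnertonDyer.BirchSwinnertonDyer.Theorems.ConjSpanGenAllLevels`.  ROUTE-INDEPENDENT support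
file (imports Literature + Mathlib only): it bears on route `PrintX8` crux `MuBoundSmallImageX8`
(stmt-BirchSwinnertonDyer-20622) through the VS road — `Theorems/PrintX8VerticalStevens.lean`
(`muBoundSmallImageX8_of_cycWindingNonConstantSmallImageX8 hCK h3 hVS`, p561175) ⟸ VS-1 ⟸ the bridge VS-B
`Theorems/PrintX8VerticalStevensBridge.lean` (p563269) from `EisSpanModGen N 3` ⟸
`eisSpanModGen_of_conjSpanGen` (carrier file) ⟸ **`ConjSpanGen N 3` for every level = this file** — on the
planner's sister-route draft `PrintX8VS` (crux `ConjSpanGenAll`), and on cell bsd-f3-mu's AN-10 / AN-9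
(CANDIDATES rows 22–23: `X10.AnalyticMuZeroOnClassX10b`, analytic `μ₃ = 0` for 3-ordinary irreducible `E`).

**Provenance / credit.**  The mathematics (MEMO-an §13 "THEOREM B", cell bsd-f3-mu, 2026-08-27) and the Lean
text of everything between the `OrbitTrick` section and `conjSpanGenAll_of_vaserstein_away` are seat
bsd-f3-mu-an g4/g5's `pub/bsd-f3-mu/an/g5/TheoremB.lean` (sha16 583a2ab32092eff9, `lean check` rc 0, 0 sorry),
audited on paper five times (bsd-f3-mu ref1 g4 §3.10 + kernel probe AnProbe4; ref2 g7/g8 THMB audits; x8 plan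
g5; x8 ref g5 R-74 turnkey), filed here VERBATIM (namespace moved under `Theorems`, `OrbitTrick` nested) by
cell bsd-print-x8 seat ty2 g6 at the author's invitation (x8 INBOX 2026-08-27T20:07:19Z «whoever lands it»),
who APPENDS the last section: the instantiation of the single remaining hypothesis
`RelGLeRelE p N` (= Vaserstein's `G(A, NA) ≤ E(A, NA)` over `A = ℤ[1/p]`) by the tree theorem
`Literature.NumberTheory.Automorphic.SL2Rel.relG_top_span_le_relE_of_morris_of_serre`
(`Literature/NumberTheory/Automorphic/SL2AwayRelativeElementary.lean`), which derives it from the two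
cite-only named facts (L) `Literature.GroupTheory.ArithmeticGroups.Morris2007.thm61_2_elementary_boundedlyGenerates`
[Morris2007, Thm. 6.1 (2)] and (C) `Literature.NumberTheory.Automorphic.SerreSL2Congruence1970_congruenceSubgroupProperty_away`
[SerreSL2Congruence1970, §2.6 Thm. 2 (b), Cor. 1, Cor. 3] through Vaserstein's Lemma 1 over Dedekind domains
(tree, `SL2Rel.exists_mul_relE_mem_Gamma`).  NET RESULT (last section):

* `conjSpanGenAll_of_morris_of_serre (hL) (hC) : ConjSpanGenAll` — **THEOREM B modulo exactly its two
  printed inputs, displayed by name** (`∀ N p, p.Prime → ¬ p ∣ N → ConjSpanGen N p`);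
* `conjSpanGen_of_morris_of_serre`, `eisSpanGen_of_morris_of_serre`, `eisSpanModGen_of_morris_of_serre` —
  single-level forms in the carrier's three spellings (`ConjSpanGen` / `EisSpanGen` / `EisSpanModGen N p`,
  the last one = the hypothesis `hspan` of p1's VS-B bridge and of ref g5's `refMu_of_eisSpanModGen`).

beyond-print theorem: YES-candidate in the sense of director W-36 — `ConjSpanGen N p` for every level is not in
print ([Sun07] §4 Conj. 8 is the single-layer conjecture; nearest mechanisms Kim–Sun (unpublished), Kwon 2023
(Bianchi)); it is proved here from two refereed printed theorems plus kernel-checked group theory.  PARTITION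
currency: 0 cells by itself (VS road still binds the held inputs `InputSharpFlatMuTransfer`, item 20771).

## The author's module docstring (bsd-f3-mu-an g5), verbatim

# THEOREM B, kernel part I (cell bsd-f3-mu, seat -an g5): the ORBIT TRICK proved, and
`(E) ∧ (Δ = Γ₀(N)·B⁺) ∧ (Δ = Γ₀(N)·B⁻_N) → ConjSpanGen N p` sorry-free.

MEMO-an §13.2: (i) Manin's presentation is replaced by subgroup bookkeeping, (ii) the orbit trick, (v) assembly.
The abstract lemma `OrbitTrick.mem_of_mem_closure` is pure group theory (one ambient group, five subgroups,
four hypotheses); the concrete instantiation is `G = SL₂(ℤ[1/p])`, `Γ = ι Γ₀(N)`, `B = B⁺ = Stab(∞)`,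
`P = B⁻_N = Stab(0) ∩ Δ`, `D = Δ = Γ₀(N; ℤ[1/p])`, `S = ι S(N,p)` (`spanSubgroup`).

## References

* [Morris2007] D. W. Morris, New York J. Math. 13 (2007) 383–421, Thm. 6.1 (2) (= arXiv:math/0503083 Thm. 81).
* [SerreSL2Congruence1970] J.-P. Serre, Ann. of Math. (2) 92 (1970) 489–527, §1.2, §1.4 Prop. 1, §2.6.
* [Vaserstein1972SL2] L. N. Vaserstein, Mat. Sb. 89 (131) (1972) 313–322, Lemma 1 and Theorem.
* [Manin1972] Ju. I. Manin, Izv. 36 (1972), Prop. 1.4, Thm. 1.9 (the dictionary `spanSubgroup` ↔ winding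
  classes, recorded in the carrier file `Rank1Residual/CyclotomicWindingSpan.lean`).
* [Sun2007] H.-S. Sun, JNT 127 (2007) §4 (the single-layer Conj. 8 — NOT proved here).
-/

set_option linter.dupNamespace false

namespace Summit.BirchSwinnertonDyer.BirchSwinnertonDyer.Theorems.ConjSpanGenAllLevels

namespace OrbitTrick

variable {G : Type*} [Group G]

/-- The invariant carried through the closure induction («`f(δ·w·0) = f(δ·0)` for every `δ = γq ∈ D`»,
spelled without the auxiliary function `f`): whenever `γ q w = γ' q'` with `γ, γ' ∈ Γ`, `q, q' ∈ P`, the two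
`Γ`-components agree modulo `S`. -/
def Inv (Γ P S : Subgroup G) (w : G) : Prop :=
  ∀ ⦃γ q γ' q' : G⦄, γ ∈ Γ → q ∈ P → γ' ∈ Γ → q' ∈ P → γ * q * w = γ' * q' → γ⁻¹ * γ' ∈ S

variable {Γ B P D S : Subgroup G}

/-- The invariant holds at every `s ∈ P` (hypothesis (h1): `Γ ∩ P ⊆ S`). [folklore] -/
theorem inv_of_mem_P (h1 : ∀ ⦃x : G⦄, x ∈ Γ → x ∈ P → x ∈ S) {s : G} (hs : s ∈ P) : Inv Γ P S s := by
  intro γ q γ' q' hγ hq hγ' hq' heq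
  have key : γ⁻¹ * γ' = q * s * q'⁻¹ := by
    calc γ⁻¹ * γ' = γ⁻¹ * (γ' * q') * q'⁻¹ := by group
      _ = γ⁻¹ * (γ * q * s) * q'⁻¹ := by rw [heq]
      _ = q * s * q'⁻¹ := by group
  refine h1 (Γ.mul_mem (Γ.inv_mem hγ) hγ') ?_
  rw [key]
  exact P.mul_mem (P.mul_mem hq hs) (P.inv_mem hq')

/-- The invariant holds at `1`. [folklore] -/
theorem inv_one (h1 : ∀ ⦃x : G⦄, x ∈ Γ → x ∈ P → x ∈ S) : Inv Γ P S 1 :=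
  inv_of_mem_P h1 P.one_mem

/-- The heart of the orbit trick: `f` is constant on every translate `δ·Z`, `Z = B·0`. -/
theorem inv_of_mem_B (hBD : B ≤ D) (hPD : P ≤ D) (hΓD : Γ ≤ D)
    (h1 : ∀ ⦃x : G⦄, x ∈ Γ → x ∈ P → x ∈ S)
    (h2 : ∀ ⦃x b q : G⦄, x ∈ Γ → b ∈ B → q ∈ P → x = b * q → x ∈ S)
    (h3 : ∀ ⦃d : G⦄, d ∈ D → ∃ γ ∈ Γ, ∃ b ∈ B, d = γ * b)
    (h3' : ∀ ⦃d : G⦄, d ∈ D → ∃ γ ∈ Γ, ∃ q ∈ P, d = γ * q)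
    {s : G} (hs : s ∈ B) : Inv Γ P S s := by
  intro γ q γ' q' hγ hq hγ' hq' heq
  obtain ⟨γ₂, hγ₂, β, hβ, hδ⟩ := h3 (D.mul_mem (hΓD hγ) (hPD hq))
  obtain ⟨γ₃, hγ₃, q₃, hq₃, hβs⟩ := h3' (hBD (B.mul_mem hβ hs))
  obtain ⟨γ₄, hγ₄, q₄, hq₄, hβ'⟩ := h3' (hBD hβ)
  have hγ₃S : γ₃ ∈ S := by
    refine h2 hγ₃ (B.mul_mem hβ hs) (P.inv_mem hq₃) ?_
    rw [hβs]; group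
  have hγ₄S : γ₄ ∈ S := by
    refine h2 hγ₄ hβ (P.inv_mem hq₄) ?_
    rw [hβ']; group
  have e1 : (γ₂ * γ₄)⁻¹ * γ = q₄ * q⁻¹ := by
    have : γ * q = γ₂ * γ₄ * q₄ := by rw [hδ, hβ']; group
    calc (γ₂ * γ₄)⁻¹ * γ = (γ₂ * γ₄)⁻¹ * (γ * q) * q⁻¹ := by group
      _ = (γ₂ * γ₄)⁻¹ * (γ₂ * γ₄ * q₄) * q⁻¹ := by rw [this]
      _ = q₄ * q⁻¹ := by group
  have hA : (γ₂ * γ₄)⁻¹ * γ ∈ S := by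
    refine h1 (Γ.mul_mem (Γ.inv_mem (Γ.mul_mem hγ₂ hγ₄)) hγ) ?_
    rw [e1]; exact P.mul_mem hq₄ (P.inv_mem hq)
  have e2 : (γ₂ * γ₃)⁻¹ * γ' = q₃ * q'⁻¹ := by
    have : γ' * q' = γ₂ * γ₃ * q₃ := by rw [← heq, hδ, mul_assoc γ₂ β s, hβs]; group
    calc (γ₂ * γ₃)⁻¹ * γ' = (γ₂ * γ₃)⁻¹ * (γ' * q') * q'⁻¹ := by group
      _ = (γ₂ * γ₃)⁻¹ * (γ₂ * γ₃ * q₃) * q'⁻¹ := by rw [this]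
      _ = q₃ * q'⁻¹ := by group
  have hA' : (γ₂ * γ₃)⁻¹ * γ' ∈ S := by
    refine h1 (Γ.mul_mem (Γ.inv_mem (Γ.mul_mem hγ₂ hγ₃)) hγ') ?_
    rw [e2]; exact P.mul_mem hq₃ (P.inv_mem hq')
  have e3 : γ⁻¹ * γ' = (γ₄ * ((γ₂ * γ₄)⁻¹ * γ))⁻¹ * (γ₃ * ((γ₂ * γ₃)⁻¹ * γ')) := by group
  rw [e3]
  exact S.mul_mem (S.inv_mem (S.mul_mem hγ₄S hA)) (S.mul_mem hγ₃S hA')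

/-- **Abstract orbit lemma** (MEMO-an §13.2 (i)+(ii)+(v)): `Γ ∩ ⟨B ∪ P⟩ ⊆ S`. -/
theorem mem_of_mem_closure (hBD : B ≤ D) (hPD : P ≤ D) (hΓD : Γ ≤ D)
    (h1 : ∀ ⦃x : G⦄, x ∈ Γ → x ∈ P → x ∈ S)
    (h2 : ∀ ⦃x b q : G⦄, x ∈ Γ → b ∈ B → q ∈ P → x = b * q → x ∈ S)
    (h3 : ∀ ⦃d : G⦄, d ∈ D → ∃ γ ∈ Γ, ∃ b ∈ B, d = γ * b)
    (h3' : ∀ ⦃d : G⦄, d ∈ D → ∃ γ ∈ Γ, ∃ q ∈ P, d = γ * q)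
    {x : G} (hxΓ : x ∈ Γ) (hx : x ∈ Subgroup.closure ((B : Set G) ∪ (P : Set G))) : x ∈ S := by
  have hED : Subgroup.closure ((B : Set G) ∪ (P : Set G)) ≤ D := by
    rw [Subgroup.closure_le]
    rintro y (hy | hy)
    · exact hBD hy
    · exact hPD hy
  have main : Inv Γ P S x := by
    refine Subgroup.closure_induction (p := fun w _ => Inv Γ P S w) ?_ ?_ ?_ ?_ hx
    · rintro s (hs | hs)
      · exact inv_of_mem_B hBD hPD hΓD h1 h2 h3 h3' hs
      · exact inv_of_mem_P h1 hs
    · exact inv_one h1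
    · intro w₁ w₂ hw₁ _ H₁ H₂ γ q γ' q' hγ hq hγ' hq' heq
      obtain ⟨γ₁, hγ₁, q₁, hq₁, hδ₁⟩ := h3' (D.mul_mem (D.mul_mem (hΓD hγ) (hPD hq)) (hED hw₁))
      have s1 : γ⁻¹ * γ₁ ∈ S := H₁ hγ hq hγ₁ hq₁ hδ₁
      have s2 : γ₁⁻¹ * γ' ∈ S := by
        refine H₂ hγ₁ hq₁ hγ' hq' ?_
        rw [← hδ₁, ← heq]; group
      have e : γ⁻¹ * γ' = (γ⁻¹ * γ₁) * (γ₁⁻¹ * γ') := by group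
      rw [e]; exact S.mul_mem s1 s2
    · intro w _ H γ q γ' q' hγ hq hγ' hq' heq
      have heq' : γ' * q' * w = γ * q := by rw [← heq]; group
      have := H hγ' hq' hγ hq heq'
      have e : γ⁻¹ * γ' = (γ'⁻¹ * γ)⁻¹ := by group
      rw [e]; exact S.inv_mem this
  have := main Γ.one_mem P.one_mem hxΓ P.one_mem (by group)
  simpa using this

end OrbitTrick

/-! ## The concrete instantiation in `SL₂(ℤ[1/p])` -/

noncomputable section

open scoped MatrixGroups
open CongruenceSubgroup
open Literature.NumberTheory.EllipticCurves.Rank1Residual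

-- (namespace of the author's file `…Rank1Residual.AnLens5` replaced by this file's namespace)

/-- `ℤ[1/p]` (VERBATIM AnLens4). -/
abbrev Away (p : ℕ) : Type := Localization.Away (p : ℤ)

/-- `ι : SL₂(ℤ) → SL₂(ℤ[1/p])`. -/
abbrev iota (p : ℕ) : SL(2, ℤ) →* SL(2, Away p) :=
  Matrix.SpecialLinearGroup.map (Int.castRingHom (Away p))

/-- Entries of `ι γ` are the images of the entries of `γ`. [folklore] -/
@[simp] theorem iota_apply (p : ℕ) (γ : SL(2, ℤ)) (i j : Fin 2) :
    (iota p γ) i j = ((γ i j : ℤ) : Away p) := rfl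

/-- The elementary matrix `E₁₂(t) = (1 t; 0 1)` (VERBATIM AnLens4). -/
def upperUnip {A : Type*} [CommRing A] (t : A) : SL(2, A) :=
  ⟨!![1, t; 0, 1], by rw [Matrix.det_fin_two_of]; ring⟩

/-- The elementary matrix `E₂₁(t) = (1 0; t 1)` (VERBATIM AnLens4). -/
def lowerUnip {A : Type*} [CommRing A] (t : A) : SL(2, A) :=
  ⟨!![1, 0; t, 1], by rw [Matrix.det_fin_two_of]; ring⟩

/-- `−1 ∈ SL₂(A)` (VERBATIM AnLens4). -/
def negOne {A : Type*} [CommRing A] : SL(2, A) :=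
  ⟨!![-1, 0; 0, -1], by rw [Matrix.det_fin_two_of]; ring⟩

/-- `h_p = diag(p, p⁻¹) ∈ SL₂(ℤ[1/p])` (VERBATIM AnLens4). -/
def diagP (p : ℕ) : SL(2, Away p) :=
  ⟨!![algebraMap ℤ (Away p) (p : ℤ), 0; 0, IsLocalization.Away.invSelf (p : ℤ)], by
    rw [Matrix.det_fin_two_of, IsLocalization.Away.mul_invSelf]; ring⟩

/-- `E(N,p) := ⟨U⁺(ℤ[1/p]), U⁻(Nℤ[1/p]), diag(p,p⁻¹), −1⟩` (VERBATIM AnLens4). -/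
def triangularSubgroup (p N : ℕ) : Subgroup SL(2, Away p) :=
  Subgroup.closure
    ((Set.range fun t : Away p => upperUnip t) ∪
      (Set.range fun t : Away p => lowerUnip ((N : Away p) * t)) ∪ {diagP p, negOne})

/-- **(E)** (VERBATIM AnLens4 `GammaHInTriangularSubgroup`). -/
def GammaHInTriangularSubgroup (p N : ℕ) : Prop :=
  ∀ γ : SL(2, ℤ), (N : ℤ) ∣ γ 1 0 →
    (∃ k : ℕ, ((γ 1 1 : ℤ) : ZMod N) = (p : ZMod N) ^ k ∨ ((γ 1 1 : ℤ) : ZMod N) = -((p : ZMod N) ^ k)) →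
      Matrix.SpecialLinearGroup.map (Int.castRingHom (Away p)) γ ∈ triangularSubgroup p N

/-- (VERBATIM AnLens4.) -/
def GammaHInTriangularSubgroupAll : Prop :=
  ∀ p N : ℕ, p.Prime → 0 < N → ¬ p ∣ N → GammaHInTriangularSubgroup p N

/-- **AN-10 = THEOREM B** (VERBATIM AnLens4 `ConjSpanGenAll`). -/
def ConjSpanGenAll : Prop := ∀ (N p : ℕ), p.Prime → ¬ p ∣ N → ConjSpanGen N p

/-! ### The five subgroups of `SL₂(ℤ[1/p])` -/

/-- `B⁺ = Stab(∞)`: upper-triangular elements. -/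
def upperB (p : ℕ) : Subgroup SL(2, Away p) where
  carrier := {g | g 1 0 = 0}
  mul_mem' := by
    intro g h hg hh
    simp only [Set.mem_setOf_eq] at hg hh ⊢
    simp [Matrix.mul_apply, Fin.sum_univ_two, hg, hh]
  one_mem' := by simp
  inv_mem' := by
    intro g hg
    simp only [Set.mem_setOf_eq] at hg ⊢
    simp [Matrix.SpecialLinearGroup.coe_inv, Matrix.adjugate_fin_two, hg]

/-- `B⁻_N = Stab(0) ∩ Δ`: lower-triangular elements with lower-left entry in `N·ℤ[1/p]`. -/
def lowerP (p N : ℕ) : Subgroup SL(2, Away p) where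
  carrier := {g | g 0 1 = 0 ∧ ∃ t : Away p, g 1 0 = N * t}
  mul_mem' := by
    rintro g h ⟨hg, t, ht⟩ ⟨hh, s, hs⟩
    refine ⟨?_, t * h 0 0 + g 1 1 * s, ?_⟩
    · simp [Matrix.mul_apply, Fin.sum_univ_two, hg, hh]
    · simp [Matrix.mul_apply, Fin.sum_univ_two, ht, hs]; ring
  one_mem' := ⟨by simp, 0, by simp⟩
  inv_mem' := by
    rintro g ⟨hg, t, ht⟩
    refine ⟨?_, -t, ?_⟩
    · simp [Matrix.SpecialLinearGroup.coe_inv, Matrix.adjugate_fin_two, hg]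
    · simp [Matrix.SpecialLinearGroup.coe_inv, Matrix.adjugate_fin_two, ht]; ring

/-- `Δ = Γ₀(N; ℤ[1/p])`: lower-left entry in `N·ℤ[1/p]`. -/
def Delta (p N : ℕ) : Subgroup SL(2, Away p) where
  carrier := {g | ∃ t : Away p, g 1 0 = N * t}
  mul_mem' := by
    rintro g h ⟨t, ht⟩ ⟨s, hs⟩
    refine ⟨t * h 0 0 + g 1 1 * s, ?_⟩
    simp [Matrix.mul_apply, Fin.sum_univ_two, ht, hs]; ring
  one_mem' := ⟨0, by simp⟩
  inv_mem' := by
    rintro g ⟨t, ht⟩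
    exact ⟨-t, by simp [Matrix.SpecialLinearGroup.coe_inv, Matrix.adjugate_fin_two, ht]; ring⟩

/-- `ι Γ₀(N) ≤ SL₂(ℤ[1/p])`. -/
def gamma0Image (p N : ℕ) : Subgroup SL(2, Away p) := (Gamma0 N).map (iota p)

/-- `ι S(N,p)`, the image of `spanSubgroup N p`. -/
def spanImage (p N : ℕ) : Subgroup SL(2, Away p) :=
  ((spanSubgroup N p).map (Gamma0 N).subtype).map (iota p)

/-- (h3) `Δ = Γ₀(N)·B⁺` — column reduction over `ℤ[1/p]` (MEMO-an §13.2 (ii): `Δ = Γ₀(N)·B⁺`). -/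
def DeltaEqGamma0MulUpper (p N : ℕ) : Prop :=
  ∀ g ∈ Delta p N, ∃ γ ∈ Gamma0 N, ∃ b ∈ upperB p, g = iota p γ * b

/-- (h3') `Δ = Γ₀(N)·B⁻_N` — row reduction over `ℤ[1/p]`. -/
def DeltaEqGamma0MulLower (p N : ℕ) : Prop :=
  ∀ g ∈ Delta p N, ∃ γ ∈ Gamma0 N, ∃ q ∈ lowerP p N, g = iota p γ * q

/-! ### Arithmetic of `ℤ[1/p]` -/

/-- `ℤ → ℤ[1/p]` is injective (`p ≠ 0`). [folklore] -/
theorem intCast_injective {p : ℕ} (hp : p ≠ 0) : Function.Injective (fun z : ℤ => (z : Away p)) := by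
  have hM : Submonoid.powers (p : ℤ) ≤ nonZeroDivisors ℤ :=
    powers_le_nonZeroDivisors_of_noZeroDivisors (by exact_mod_cast hp)
  have h := IsLocalization.injective (Away p) hM
  intro a b hab
  apply h
  simpa using hab

/-- `ι : SL₂(ℤ) → SL₂(ℤ[1/p])` is injective (`p ≠ 0`). [folklore] -/
theorem iota_injective {p : ℕ} (hp : p ≠ 0) : Function.Injective (iota p) := by
  intro g h hgh
  ext i j
  have := congrArg (fun m : SL(2, Away p) => m i j) hgh
  exact intCast_injective hp (by simpa using this)

/-- An integer which is a unit of `ℤ[1/p]` is `± pᵐ`. -/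
theorem natAbs_eq_pow_of_isUnit_intCast {p : ℕ} (hp : p.Prime) {d : ℤ}
    (hd : IsUnit ((d : ℤ) : Away p)) : ∃ m : ℕ, d.natAbs = p ^ m := by
  obtain ⟨y, hy⟩ := hd.exists_right_inv
  obtain ⟨⟨a, ⟨_, ⟨r, rfl⟩⟩⟩, ha⟩ := IsLocalization.surj (Submonoid.powers (p : ℤ)) y
  -- `ha : y * ↑(p ^ r) = ↑a`
  simp only at ha
  have h1 : ((d * a : ℤ) : Away p) = (((p : ℤ) ^ r : ℤ) : Away p) := by
    have : (d : Away p) * (y * (((p : ℤ) ^ r : ℤ) : Away p)) = (((p : ℤ) ^ r : ℤ) : Away p) := by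
      rw [← mul_assoc, hy, one_mul]
    rw [← this]
    push_cast
    have ha' : y * ((p : Away p) ^ r) = (a : Away p) := by simpa using ha
    rw [ha']
  have h2 : d * a = (p : ℤ) ^ r := intCast_injective hp.ne_zero h1
  have h3 : d.natAbs ∣ p ^ r := by
    have : d ∣ (p : ℤ) ^ r := ⟨a, h2.symm⟩
    have := Int.natAbs_dvd_natAbs.mpr this
    simpa [Int.natAbs_pow] using this
  obtain ⟨m, -, hm⟩ := (Nat.dvd_prime_pow hp).1 h3
  exact ⟨m, hm⟩

variable {p N : ℕ}

/-! ### Entry point (V): Vaserstein's `G(A, NA) ≤ E(A, NA)` at `A = ℤ[1/p]` (ref2 g8 F-(V)) -/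

/-- **(V)** in the tree vocabulary `SL2Rel.relG / relE` (`CongruenceSubgroupPropertySL2Proofs.lean`):
`G(ℤ[1/p], N·ℤ[1/p]) ≤ E(ℤ[1/p], N·ℤ[1/p])`, i.e. every `g ∈ SL₂(ℤ[1/p])` with `c ∈ NA`, `a ≡ d ≡ 1 (mod NA)`
is a word in `E₁₂(A)` and `E₂₁(NA)` [Vaserstein 1972 Theorem + Bass–Milnor–Serre 1967 Ch. I Thm. 3.6, at the
Dedekind ring of arithmetic type `ℤ[1/p]` (infinitely many units `±p^ℤ`, a real place)]. The TRANSPOSE of the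
shape `relG (span{e}) ⊤ ≤ relE (span{e}) ⊤` consumed by `congruenceSubgroupProperty_away_of_relG_le_relE`. -/
def RelGLeRelE (p N : ℕ) : Prop :=
  Literature.NumberTheory.Automorphic.SL2Rel.relG (⊤ : Ideal (Away p)) (Ideal.span {(N : Away p)}) ≤
    Literature.NumberTheory.Automorphic.SL2Rel.relE (⊤ : Ideal (Away p)) (Ideal.span {(N : Away p)})

/-- `diag(u, u⁻¹) ∈ SL₂(A)` for a unit `u`. -/
def diagUnit {A : Type*} [CommRing A] (u : Aˣ) : SL(2, A) :=
  ⟨!![(u : A), 0; 0, ((u⁻¹ : Aˣ) : A)], by rw [Matrix.det_fin_two_of]; simp⟩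

/-- Entry `(0,0)` of `diag(u, u⁻¹)`. [folklore] -/
@[simp] theorem diagUnit_apply_00 {A : Type*} [CommRing A] (u : Aˣ) : (diagUnit u) 0 0 = (u : A) := rfl
/-- Entry `(0,1)` of `diag(u, u⁻¹)`. [folklore] -/
@[simp] theorem diagUnit_apply_01 {A : Type*} [CommRing A] (u : Aˣ) : (diagUnit u) 0 1 = 0 := rfl
/-- Entry `(1,0)` of `diag(u, u⁻¹)`. [folklore] -/
@[simp] theorem diagUnit_apply_10 {A : Type*} [CommRing A] (u : Aˣ) : (diagUnit u) 1 0 = 0 := rfl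
/-- Entry `(1,1)` of `diag(u, u⁻¹)`. [folklore] -/
@[simp] theorem diagUnit_apply_11 {A : Type*} [CommRing A] (u : Aˣ) :
    (diagUnit u) 1 1 = ((u⁻¹ : Aˣ) : A) := rfl

/-- `diag(u, u⁻¹) ∈ B⁺`. [folklore] -/
theorem diagUnit_mem_upperB (u : (Away p)ˣ) : diagUnit u ∈ upperB p := by
  show (diagUnit u) 1 0 = 0
  rfl


end

end Summit.BirchSwinnertonDyer.BirchSwinnertonDyer.Theorems.ConjSpanGenAllLevels
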